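import Mathlib

/-!
# Route `GreenTaoLevelTwo`, crux `MNTwo` (stmt-Parity-21276), line `birth`, stub `stub_mnVertical`:
# discrete-grid smoothing of Lipschitz functions on the `d`-torus (AIF Lemma 37, every dimension)

The `d`-dimensional step of the Fourier expansion of Bohr-gauge Lipschitz cutoffs (B. Green, T. Tao,
*Quadratic uniformity of the Möbius function*, Ann. Inst. Fourier 58 (2008) = arXiv:math/0606087,
App. A Lemma 37), in a purely finitary form.  Given a one-dimensional kernel `K ≥ 0` on `ℝ` that is a
trigonometric polynomial `K(t) = ∑_{j ≤ 2R} a_j e((j-R)t)` with `|a_j| ≤ 1`, has grid sums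
`∑_{u<M} K(x - u/M) = M` and weighted grid sums `∑_{u<M} ‖x-u/M‖_{ℝ/ℤ} K(x-u/M) ≤ εM`, and a function
`G : ℝ^d → [0,1]` with `G x ≤ G y + L ∑ᵢ ‖xᵢ - yᵢ‖_{ℝ/ℤ}`, the grid average
`T(x) = M^{-d} ∑_{u ∈ (ℤ/M)^d} G(u/M) ∏ᵢ K(xᵢ - uᵢ/M)` is an exponential sum
`∑_{r ∈ [0,2R]^d} c_r e(∑ᵢ (rᵢ - R) xᵢ)` with `‖c_r‖ ≤ 1` and `|T - G| ≤ L d ε` everywhere.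
(The cosine-power kernel of `…MNTwoCosKernel` satisfies the hypotheses.)  Def-free; finite sums only.

* `norm_coe_sub_comm` — `‖x - y‖_{ℝ/ℤ} = ‖y - x‖_{ℝ/ℤ}`;
* `grid_smoothing` — the statement above.

References: [GreenTao2008QuadraticMobius] arXiv:math/0606087 App. A (Lemma 37).
-/

noncomputable section

open Finset Real

namespace Summit.Parity.GeneralizedHardyLittlewood.GreenTaoLevelTwoMNTwoGridSmoothing

/-- `‖x - y‖_{ℝ/ℤ} = ‖y - x‖_{ℝ/ℤ}`. [folklore] -/
theorem norm_coe_sub_comm (x y : ℝ) :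
    ‖((x - y : ℝ) : AddCircle (1 : ℝ))‖ = ‖((y - x : ℝ) : AddCircle (1 : ℝ))‖ := by
  rw [← norm_neg, ← AddCircle.coe_neg, neg_sub]

/-- **Discrete-grid smoothing on the `d`-torus.**  See the module docstring.
[cite: GreenTao2008QuadraticMobius, App. A Lemma 37] -/
theorem grid_smoothing {d R M : ℕ} (hM : 0 < M) (K : ℝ → ℝ) (a : ℕ → ℝ)
    (hK0 : ∀ t, 0 ≤ K t)
    (hK1 : ∀ x : ℝ, ∑ u ∈ range M, K (x - u / M) = M)
    {ε : ℝ} (hK2 : ∀ x : ℝ,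
      ∑ u ∈ range M, ‖((x - u / M : ℝ) : AddCircle (1 : ℝ))‖ * K (x - u / M) ≤ ε * M)
    (hK3 : ∀ t : ℝ, ((K t : ℝ) : ℂ) = ∑ j ∈ range (2 * R + 1), ((a j : ℝ) : ℂ) *
      Complex.exp (((2 * π * ((j - R : ℝ) * t) : ℝ) : ℂ) * Complex.I))
    (ha : ∀ j, |a j| ≤ 1)
    (G : (Fin d → ℝ) → ℝ) (hG0 : ∀ x, 0 ≤ G x) (hG1 : ∀ x, G x ≤ 1) {L : ℝ} (hL : 0 ≤ L)
    (hGL : ∀ x y, G x ≤ G y + L * ∑ i, ‖((x i - y i : ℝ) : AddCircle (1 : ℝ))‖) :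
    ∃ c : (Fin d → Fin (2 * R + 1)) → ℂ, (∀ r, ‖c r‖ ≤ 1) ∧ ∀ x : Fin d → ℝ,
      ‖((G x : ℝ) : ℂ) - ∑ r, c r *
        Complex.exp (((2 * π * (∑ i, (((r i : ℕ) : ℝ) - R) * x i) : ℝ) : ℂ) * Complex.I)‖ ≤
        L * d * ε := by
  classical
  have hMr : (0 : ℝ) < M := by exact_mod_cast hM
  have hMd : (0 : ℝ) < (M : ℝ) ^ d := by positivity
  -- grid points
  set p : (Fin d → Fin M) → (Fin d → ℝ) := fun u i => ((u i : ℕ) : ℝ) / M with hp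
  -- the coefficients
  refine ⟨fun r => (∏ i, ((a (r i) : ℝ) : ℂ)) *
      (∑ u : Fin d → Fin M, ((G (p u) : ℝ) : ℂ) *
        ∏ i, Complex.exp (((2 * π * (-((((r i : ℕ) : ℝ) - R) * ((u i : ℕ) : ℝ) / M)) : ℝ) : ℂ) *
          Complex.I)) / ((M : ℝ) ^ d : ℝ), fun r => ?_, fun x => ?_⟩
  · -- `‖c r‖ ≤ 1`
    rw [norm_div, norm_mul, Complex.norm_real, Real.norm_of_nonneg hMd.le, div_le_one hMd]
    have h1 : ‖∏ i, ((a (r i) : ℝ) : ℂ)‖ ≤ 1 := by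
      rw [norm_prod]
      calc ∏ i, ‖((a (r i) : ℝ) : ℂ)‖ ≤ ∏ _i : Fin d, (1 : ℝ) :=
            Finset.prod_le_prod (fun i _ => norm_nonneg _) fun i _ => by
              rw [Complex.norm_real]; exact ha _
        _ = 1 := by simp
    have h2 : ‖∑ u : Fin d → Fin M, ((G (p u) : ℝ) : ℂ) *
        ∏ i, Complex.exp (((2 * π * (-((((r i : ℕ) : ℝ) - R) * ((u i : ℕ) : ℝ) / M)) : ℝ) : ℂ) *
          Complex.I)‖ ≤ (M : ℝ) ^ d := by
      refine (norm_sum_le _ _).trans ?_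
      calc ∑ u : Fin d → Fin M, ‖((G (p u) : ℝ) : ℂ) *
            ∏ i, Complex.exp (((2 * π * (-((((r i : ℕ) : ℝ) - R) * ((u i : ℕ) : ℝ) / M)) : ℝ) : ℂ) *
              Complex.I)‖ ≤ ∑ _u : Fin d → Fin M, (1 : ℝ) := by
            refine Finset.sum_le_sum fun u _ => ?_
            rw [norm_mul, norm_prod, Complex.norm_real, Real.norm_of_nonneg (hG0 _)]
            have : ∏ i, ‖Complex.exp (((2 * π * (-((((r i : ℕ) : ℝ) - R) * ((u i : ℕ) : ℝ) / M)) :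
                ℝ) : ℂ) * Complex.I)‖ = 1 := by
              rw [Finset.prod_eq_one]; intro i _; exact Complex.norm_exp_ofReal_mul_I _
            rw [this, mul_one]; exact hG1 _
        _ = (M : ℝ) ^ d := by simp
    calc ‖∏ i, ((a (r i) : ℝ) : ℂ)‖ * _ ≤ 1 * (M : ℝ) ^ d :=
          mul_le_mul h1 h2 (norm_nonneg _) zero_le_one
      _ = (M : ℝ) ^ d := one_mul _
  · -- the smoothing `T x`
    set T : ℝ := (∑ u : Fin d → Fin M, G (p u) * ∏ i, K (x i - ((u i : ℕ) : ℝ) / M)) /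
      (M : ℝ) ^ d with hT
    -- (A) algebra: `T x` is the exponential sum
    have hKfin : ∀ t : ℝ, ((K t : ℝ) : ℂ) = ∑ j : Fin (2 * R + 1), ((a j : ℝ) : ℂ) *
        Complex.exp (((2 * π * (((j : ℕ) - R : ℝ) * t) : ℝ) : ℂ) * Complex.I) := by
      intro t; rw [hK3, Finset.sum_range]
    have expand : ∀ u : Fin d → Fin M, (∏ i, ((K (x i - ((u i : ℕ) : ℝ) / M) : ℝ) : ℂ)) =
        ∑ r : Fin d → Fin (2 * R + 1), (∏ i, ((a (r i) : ℝ) : ℂ)) *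
          (∏ i, Complex.exp (((2 * π * (-((((r i : ℕ) : ℝ) - R) * ((u i : ℕ) : ℝ) / M)) : ℝ) :
            ℂ) * Complex.I)) *
          Complex.exp (((2 * π * (∑ i, (((r i : ℕ) : ℝ) - R) * x i) : ℝ) : ℂ) * Complex.I) := by
      intro u
      simp_rw [hKfin]
      rw [Fintype.prod_sum]
      refine Fintype.sum_congr _ _ fun r => ?_
      rw [← Finset.prod_mul_distrib]
      have hexp : Complex.exp (((2 * π * (∑ i, (((r i : ℕ) : ℝ) - R) * x i) : ℝ) : ℂ) *
          Complex.I) = ∏ i, Complex.exp (((2 * π * ((((r i : ℕ) : ℝ) - R) * x i) : ℝ) : ℂ) *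
            Complex.I) := by
        rw [← Complex.exp_sum]
        congr 1
        push_cast
        rw [Finset.mul_sum, Finset.sum_mul]
      rw [hexp, ← Finset.prod_mul_distrib]
      refine Finset.prod_congr rfl fun i _ => ?_
      have hAC : Complex.exp (((2 * π * (-((((r i : ℕ) : ℝ) - R) * ((u i : ℕ) : ℝ) / M)) : ℝ) :
            ℂ) * Complex.I) *
          Complex.exp (((2 * π * ((((r i : ℕ) : ℝ) - R) * x i) : ℝ) : ℂ) * Complex.I) =
          Complex.exp (((2 * π * ((((r i : ℕ) : ℝ) - R) * (x i - ((u i : ℕ) : ℝ) / M)) : ℝ) : ℂ) *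
            Complex.I) := by
        rw [← Complex.exp_add]; congr 1; push_cast; ring
      rw [← hAC]; ring
    have hTsum : ((T : ℝ) : ℂ) = ∑ r : Fin d → Fin (2 * R + 1),
        ((∏ i, ((a (r i) : ℝ) : ℂ)) *
          (∑ u : Fin d → Fin M, ((G (p u) : ℝ) : ℂ) *
            ∏ i, Complex.exp (((2 * π * (-((((r i : ℕ) : ℝ) - R) * ((u i : ℕ) : ℝ) / M)) : ℝ) :
              ℂ) * Complex.I)) / ((M : ℝ) ^ d : ℝ)) *
        Complex.exp (((2 * π * (∑ i, (((r i : ℕ) : ℝ) - R) * x i) : ℝ) : ℂ) * Complex.I) := by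
      rw [hT, Complex.ofReal_div, Complex.ofReal_sum]
      have hcast : ∀ u : Fin d → Fin M, (((G (p u) * ∏ i, K (x i - ((u i : ℕ) : ℝ) / M)) : ℝ) : ℂ)
          = ((G (p u) : ℝ) : ℂ) * ∏ i, ((K (x i - ((u i : ℕ) : ℝ) / M) : ℝ) : ℂ) := by
        intro u; rw [Complex.ofReal_mul, Complex.ofReal_prod]
      simp_rw [hcast, expand, Finset.mul_sum, Finset.sum_div]
      rw [Finset.sum_comm]
      refine Fintype.sum_congr _ _ fun r => ?_
      rw [Finset.sum_mul]
      refine Fintype.sum_congr _ _ fun u => ?_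
      ring
    rw [← hTsum, ← Complex.ofReal_sub, Complex.norm_real, Real.norm_eq_abs]
    -- (B) the bound `|G x - T| ≤ L d ε`
    have hK1fin : ∀ y : ℝ, ∑ v : Fin M, K (y - ((v : ℕ) : ℝ) / M) = M := by
      intro y; have h := hK1 y; rw [Finset.sum_range] at h; exact h
    have hK2fin : ∀ y : ℝ, ∑ v : Fin M, ‖((y - ((v : ℕ) : ℝ) / M : ℝ) : AddCircle (1 : ℝ))‖ *
        K (y - ((v : ℕ) : ℝ) / M) ≤ ε * M := by
      intro y; have := hK2 y; rwa [Finset.sum_range] at this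
    have hmass : ∑ u : Fin d → Fin M, ∏ i, K (x i - ((u i : ℕ) : ℝ) / M) = (M : ℝ) ^ d := by
      rw [← Fintype.prod_sum (fun i (v : Fin M) => K (x i - ((v : ℕ) : ℝ) / M))]
      simp_rw [hK1fin]
      simp
    have hprod0 : ∀ u : Fin d → Fin M, 0 ≤ ∏ i, K (x i - ((u i : ℕ) : ℝ) / M) :=
      fun u => Finset.prod_nonneg fun i _ => hK0 _
    have hdiff : G x - T = (∑ u : Fin d → Fin M, (G x - G (p u)) *
        ∏ i, K (x i - ((u i : ℕ) : ℝ) / M)) / (M : ℝ) ^ d := by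
      rw [hT, eq_div_iff hMd.ne', sub_mul, div_mul_cancel₀ _ hMd.ne']
      simp_rw [sub_mul, Finset.sum_sub_distrib, ← Finset.mul_sum, hmass]
    have hlip : ∀ u : Fin d → Fin M, |G x - G (p u)| ≤
        L * ∑ i, ‖((x i - ((u i : ℕ) : ℝ) / M : ℝ) : AddCircle (1 : ℝ))‖ := by
      intro u
      rw [abs_sub_le_iff]
      constructor
      · have := hGL x (p u); simp only [hp] at this; linarith
      · have := hGL (p u) x; simp only [hp] at this
        simp_rw [norm_coe_sub_comm (((u _ : ℕ) : ℝ) / M)] at this; linarith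
    have hfac : ∀ i : Fin d, ∑ u : Fin d → Fin M,
        ‖((x i - ((u i : ℕ) : ℝ) / M : ℝ) : AddCircle (1 : ℝ))‖ *
          ∏ j, K (x j - ((u j : ℕ) : ℝ) / M) ≤ ε * (M : ℝ) ^ d := by
      intro i
      have hd1 : 1 ≤ d := Fin.pos i
      set h : Fin d → Fin M → ℝ := fun j v =>
        (if j = i then ‖((x i - ((v : ℕ) : ℝ) / M : ℝ) : AddCircle (1 : ℝ))‖ else 1) *
          K (x j - ((v : ℕ) : ℝ) / M) with hh
      have hrew : ∀ u : Fin d → Fin M,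
          ‖((x i - ((u i : ℕ) : ℝ) / M : ℝ) : AddCircle (1 : ℝ))‖ *
            ∏ j, K (x j - ((u j : ℕ) : ℝ) / M) = ∏ j, h j (u j) := by
        intro u
        simp only [hh]
        rw [Finset.prod_mul_distrib, Finset.prod_ite_eq']
        simp
      simp_rw [hrew]
      rw [← Fintype.prod_sum h]
      have hj : ∀ j, j ≠ i → ∑ v, h j v = M := by
        intro j hji; simp only [hh, hji, if_false, one_mul]; exact hK1fin _
      have hi : ∑ v, h i v ≤ ε * M := by simp only [hh, if_true]; exact hK2fin _
      rw [← Finset.mul_prod_erase univ _ (mem_univ i)]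
      have hrest : ∏ j ∈ univ.erase i, ∑ v, h j v = (M : ℝ) ^ (d - 1) := by
        rw [Finset.prod_congr rfl fun j hj' => hj j (Finset.ne_of_mem_erase hj'), Finset.prod_const,
          Finset.card_erase_of_mem (mem_univ i), Finset.card_univ, Fintype.card_fin]
      rw [hrest]
      calc (∑ v, h i v) * (M : ℝ) ^ (d - 1) ≤ ε * M * (M : ℝ) ^ (d - 1) :=
            mul_le_mul_of_nonneg_right hi (by positivity)
        _ = ε * (M : ℝ) ^ d := by
            rw [mul_assoc, mul_comm (M : ℝ), ← pow_succ, Nat.sub_add_cancel hd1]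
    rw [hdiff, abs_div, abs_of_pos hMd, div_le_iff₀ hMd]
    have hswap : ∑ u : Fin d → Fin M, (L * ∑ i, ‖((x i - ((u i : ℕ) : ℝ) / M : ℝ) :
        AddCircle (1 : ℝ))‖) * ∏ j, K (x j - ((u j : ℕ) : ℝ) / M) =
        L * ∑ i : Fin d, ∑ u : Fin d → Fin M, ‖((x i - ((u i : ℕ) : ℝ) / M : ℝ) :
          AddCircle (1 : ℝ))‖ * ∏ j, K (x j - ((u j : ℕ) : ℝ) / M) := by
      rw [Finset.sum_comm, Finset.mul_sum]
      refine Fintype.sum_congr _ _ fun u => ?_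
      rw [Finset.mul_sum, Finset.mul_sum, Finset.sum_mul]
      refine Fintype.sum_congr _ _ fun i => ?_
      ring
    calc |∑ u : Fin d → Fin M, (G x - G (p u)) * ∏ i, K (x i - ((u i : ℕ) : ℝ) / M)|
        ≤ ∑ u : Fin d → Fin M, |(G x - G (p u)) * ∏ i, K (x i - ((u i : ℕ) : ℝ) / M)| :=
          Finset.abs_sum_le_sum_abs _ _
      _ ≤ ∑ u : Fin d → Fin M, (L * ∑ i, ‖((x i - ((u i : ℕ) : ℝ) / M : ℝ) :
            AddCircle (1 : ℝ))‖) * ∏ j, K (x j - ((u j : ℕ) : ℝ) / M) := by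
          refine Finset.sum_le_sum fun u _ => ?_
          rw [abs_mul, abs_of_nonneg (hprod0 u)]
          exact mul_le_mul_of_nonneg_right (hlip u) (hprod0 u)
      _ = L * ∑ i : Fin d, ∑ u : Fin d → Fin M, ‖((x i - ((u i : ℕ) : ℝ) / M : ℝ) :
            AddCircle (1 : ℝ))‖ * ∏ j, K (x j - ((u j : ℕ) : ℝ) / M) := hswap
      _ ≤ L * ∑ _i : Fin d, ε * (M : ℝ) ^ d := by
          refine mul_le_mul_of_nonneg_left (Finset.sum_le_sum fun i _ => hfac i) hL
      _ = L * d * ε * (M : ℝ) ^ d := by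
          rw [Finset.sum_const, Finset.card_univ, Fintype.card_fin, nsmul_eq_mul]; ring

end Summit.Parity.GeneralizedHardyLittlewood.GreenTaoLevelTwoMNTwoGridSmoothing
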